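import Mathlib

/-!
# LINE LAW — the one-sided bookkeeping identity behind the general class law (ENGINE-W code B, #B14)

For the order `ℤ√d` and an integer `A` with `n₁ * n₂ ∣ A² - d`, write `𝔞ₙ(A) = (n, -A + √d)` for the
primitive-ideal candidate of norm `n` through `A - √d`.  THEOREM E of the LINE LAW (card LINE-LAW-B.md §22,
LINE-LAW-THEOREMS-B.md §6″) needs the multiplicativity `𝔞_{n₁}(A) · 𝔞_{n₂}(A) = 𝔞_{n₁ n₂}(A)` not only for
coprime `n₁, n₂` (that case is `primIdeal_mul_of_coprime` in LineLawRamifiedCapture.lean) but whenever the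
form `(n₁, 2A, (A² - d)/n₁)` is primitive at the primes shared with `n₂` — precisely: whenever
`gcd(n₁, n₂, 2A) = 1`, witnessed here by a three-term Bézout relation `u n₁ + v n₂ + w (2A) = 1`.
The proof is the explicit generator computation
`(-A + √d) = u·n₁(-A + √d) + v·n₂(-A + √d) + w·(-( -A + √d)² - k n₁ n₂)` (using `n₁ n₂ k = A² - d`).
Honest framing: ring algebra in `ℤ√d` only; Mukai vectors and lattices elsewhere, not objects; nothing here
says that HC, HC_CM or HC_AV holds.
-/

namespace HSemireg.LineLawIdealProduct

open Zsqrtd Ideal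

/-- The key ring identity: `2A · X = -(X²) - k n₁ n₂` in `ℤ√d` when `n₁ n₂ k = A² - d`, `X := -A + √d`. -/
theorem twoA_mul_X {d A n₁ n₂ k : ℤ} (hk : n₁ * n₂ * k = A * A - d) :
    ((2 * A : ℤ) : ℤ√d) * (⟨-A, 1⟩ : ℤ√d) = -((⟨-A, 1⟩ : ℤ√d) * (⟨-A, 1⟩ : ℤ√d)) - ((k * (n₁ * n₂) : ℤ) : ℤ√d) := by
  ext <;> simp <;> nlinarith [hk]

/-- ONE-SIDED BOOKKEEPING: `(n₁, X) · (n₂, X) = (n₁ n₂, X)` for `X := -A + √d`, whenever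
`n₁ n₂ ∣ A² - d` (via `n₁ n₂ k = A² - d`) and `gcd(n₁, n₂, 2A) = 1` (via Bézout coefficients `u, v, w`).
This is the identity `𝔞_{n₁}(A) 𝔞_{n₂}(A) = 𝔞_{n₁n₂}(A)` used in THEOREM E «⇒»; the coprime case
(`w = 0`) is LineLawRamifiedCapture.primIdeal_mul_of_coprime. -/
theorem span_pair_mul_span_pair_eq {d A : ℤ} (n₁ n₂ k u v w : ℤ)
    (hk : n₁ * n₂ * k = A * A - d) (hbez : u * n₁ + v * n₂ + w * (2 * A) = 1) :
    Ideal.span {(n₁ : ℤ√d), (⟨-A, 1⟩ : ℤ√d)} * Ideal.span {(n₂ : ℤ√d), (⟨-A, 1⟩ : ℤ√d)}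
      = Ideal.span {((n₁ * n₂ : ℤ) : ℤ√d), (⟨-A, 1⟩ : ℤ√d)} := by
  apply _root_.le_antisymm
  · -- `≤`: every product of generators lies in `(n₁ n₂, X)`
    rw [Ideal.span_pair_mul_span_pair]
    apply Ideal.span_le.2
    have hX : (⟨-A, 1⟩ : ℤ√d) ∈ Ideal.span {((n₁ * n₂ : ℤ) : ℤ√d), (⟨-A, 1⟩ : ℤ√d)} :=
      Ideal.subset_span (by simp)
    have hN : ((n₁ * n₂ : ℤ) : ℤ√d) ∈ Ideal.span {((n₁ * n₂ : ℤ) : ℤ√d), (⟨-A, 1⟩ : ℤ√d)} :=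
      Ideal.subset_span (by simp)
    intro z hz
    simp only [Set.mem_insert_iff, Set.mem_singleton_iff] at hz
    rcases hz with rfl | rfl | rfl | rfl
    · have : ((n₁ : ℤ√d)) * (n₂ : ℤ√d) = ((n₁ * n₂ : ℤ) : ℤ√d) := by push_cast; ring
      rw [this]; exact hN
    · exact Ideal.mul_mem_left _ _ hX
    · exact Ideal.mul_mem_right _ _ hX
    · exact Ideal.mul_mem_left _ _ hX
  · -- `≥`: `n₁ n₂` and `X` lie in the product
    apply Ideal.span_le.2
    have h1 : (n₁ : ℤ√d) * (⟨-A, 1⟩ : ℤ√d) ∈ Ideal.span {(n₁ : ℤ√d), (⟨-A, 1⟩ : ℤ√d)} * Ideal.span {(n₂ : ℤ√d), (⟨-A, 1⟩ : ℤ√d)} :=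
      Ideal.mul_mem_mul (Ideal.subset_span (by simp)) (Ideal.subset_span (by simp))
    have h2 : (⟨-A, 1⟩ : ℤ√d) * (n₂ : ℤ√d) ∈ Ideal.span {(n₁ : ℤ√d), (⟨-A, 1⟩ : ℤ√d)} * Ideal.span {(n₂ : ℤ√d), (⟨-A, 1⟩ : ℤ√d)} :=
      Ideal.mul_mem_mul (Ideal.subset_span (by simp)) (Ideal.subset_span (by simp))
    have h3 : (⟨-A, 1⟩ : ℤ√d) * (⟨-A, 1⟩ : ℤ√d) ∈ Ideal.span {(n₁ : ℤ√d), (⟨-A, 1⟩ : ℤ√d)} * Ideal.span {(n₂ : ℤ√d), (⟨-A, 1⟩ : ℤ√d)} :=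
      Ideal.mul_mem_mul (Ideal.subset_span (by simp)) (Ideal.subset_span (by simp))
    have h4 : (n₁ : ℤ√d) * (n₂ : ℤ√d) ∈ Ideal.span {(n₁ : ℤ√d), (⟨-A, 1⟩ : ℤ√d)} * Ideal.span {(n₂ : ℤ√d), (⟨-A, 1⟩ : ℤ√d)} :=
      Ideal.mul_mem_mul (Ideal.subset_span (by simp)) (Ideal.subset_span (by simp))
    intro z hz
    simp only [Set.mem_insert_iff, Set.mem_singleton_iff] at hz
    rcases hz with rfl | rfl
    · have : ((n₁ * n₂ : ℤ) : ℤ√d) = (n₁ : ℤ√d) * (n₂ : ℤ√d) := by push_cast; ring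
      rw [this]; exact h4
    · -- X = u n₁ X + v X n₂ + w (-(X X) - k n₁ n₂)
      set P := Ideal.span {(n₁ : ℤ√d), (⟨-A, 1⟩ : ℤ√d)} * Ideal.span {(n₂ : ℤ√d), (⟨-A, 1⟩ : ℤ√d)} with hP
      have key : (⟨-A, 1⟩ : ℤ√d) = (u : ℤ√d) * ((n₁ : ℤ√d) * (⟨-A, 1⟩ : ℤ√d)) + (v : ℤ√d) * ((⟨-A, 1⟩ : ℤ√d) * (n₂ : ℤ√d))
          + (w : ℤ√d) * (-((⟨-A, 1⟩ : ℤ√d) * (⟨-A, 1⟩ : ℤ√d)) - ((k * (n₁ * n₂) : ℤ) : ℤ√d)) := by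
        ext
        · simp; linear_combination A * hbez + w * hk
        · simp; linear_combination -hbez
      have hk4 : ((k * (n₁ * n₂) : ℤ) : ℤ√d) ∈ P := by
        have : ((k * (n₁ * n₂) : ℤ) : ℤ√d) = (k : ℤ√d) * ((n₁ : ℤ√d) * (n₂ : ℤ√d)) := by push_cast; ring
        rw [this]; exact Ideal.mul_mem_left _ _ h4
      have hmem : (u : ℤ√d) * ((n₁ : ℤ√d) * (⟨-A, 1⟩ : ℤ√d)) + (v : ℤ√d) * ((⟨-A, 1⟩ : ℤ√d) * (n₂ : ℤ√d))
          + (w : ℤ√d) * (-((⟨-A, 1⟩ : ℤ√d) * (⟨-A, 1⟩ : ℤ√d)) - ((k * (n₁ * n₂) : ℤ) : ℤ√d)) ∈ P :=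
        P.add_mem (P.add_mem (P.mul_mem_left _ h1) (P.mul_mem_left _ h2))
          (P.mul_mem_left _ (P.sub_mem (P.neg_mem h3) hk4))
      rw [key]; exact hmem

/-- Usable corollary with the hypotheses as divisibility∕gcd facts: if `n₁ n₂ ∣ A² - d` and
`gcd(gcd(n₁, n₂), 2A) = 1` then `(n₁, X)(n₂, X) = (n₁ n₂, X)`. -/
theorem primIdeal_mul_of_gcd {d A n₁ n₂ : ℤ} (hdvd : n₁ * n₂ ∣ A * A - d)
    (hg : Int.gcd (Int.gcd n₁ n₂ : ℤ) (2 * A) = 1) :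
    Ideal.span {(n₁ : ℤ√d), (⟨-A, 1⟩ : ℤ√d)} * Ideal.span {(n₂ : ℤ√d), (⟨-A, 1⟩ : ℤ√d)}
      = Ideal.span {((n₁ * n₂ : ℤ) : ℤ√d), (⟨-A, 1⟩ : ℤ√d)} := by
  obtain ⟨k, hk⟩ := hdvd
  have hb := Int.gcd_eq_gcd_ab (Int.gcd n₁ n₂ : ℤ) (2 * A)
  rw [hg] at hb
  have hb' := Int.gcd_eq_gcd_ab n₁ n₂
  -- 1 = g * a + 2A * b with g = n₁ a' + n₂ b'
  set a := Int.gcdA (Int.gcd n₁ n₂ : ℤ) (2 * A)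
  set b := Int.gcdB (Int.gcd n₁ n₂ : ℤ) (2 * A)
  set a' := Int.gcdA n₁ n₂
  set b' := Int.gcdB n₁ n₂
  refine span_pair_mul_span_pair_eq n₁ n₂ k (a' * a) (b' * a) b hk.symm ?_
  have : ((Int.gcd n₁ n₂ : ℕ) : ℤ) = n₁ * a' + n₂ * b' := hb'
  push_cast at hb
  rw [this] at hb
  linear_combination -hb

end HSemireg.LineLawIdealProduct
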